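import Summits.ResolutionOfSingularities.ResolutionOfSingularities.Theorems.FrobeniusLadderFInjectiveMacaulayficationFedderAtMaximalIdeal
import Summits.ResolutionOfSingularities.ResolutionOfSingularities.Theorems.FrobeniusLadderFInjectiveMacaulayficationSeparableBaseChangeAscent
import Mathlib.Algebra.CharP.Lemmas
import HarnessLib

/-!
# Fedder's test on the wild `p`-cover `z^p = F(x)` and on its blow-up charts `x^c z^p = G(x)`: it lives one dimension down
# (lead-1's #8w W1; desk R24.3 (2) dictionary)

[OURS · L1 W4.5a] Support file (`--supports stmt-ResolutionOfSingularities-15315 --as helper`); theorems only; unconditional; any field `k` of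
characteristic `p`. Nothing of the crux is proved; no census.

Letters: `S = k[z, x₁..xₙ] = MvPolynomial (Fin (n+1)) k` with `z := X 0`, `xᵢ := X i.succ`; a `z`-free polynomial is `rename Fin.succ F`,
`F : MvPolynomial (Fin n) k`. The two algebraic facts behind the dictionary «FULL(Y_p) ⟺ Fedder of the BASE hypersurface (and its ζ-twists)»:
(i) `(T − h)^m ≡ (−h)^m (mod T)` in any commutative ring, so for an ideal `J ∋ T`: `(T − h)^m ∈ J ↔ h^m ∈ J` (`sub_pow_mem_iff`); (ii) along the
retraction `ι = rename Fin.succ : k[x] → k[x, z]`, `σ = (z ↦ ζ) : k[x, z] → k[x]`, membership of `ι h` in an ideal `J` with `ι I ⊆ J`,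
`σ J ⊆ I` is membership of `h` in `I` (`mem_iff_of_retract`). With `T = z^p` resp. `T = x^c (z − ζ)^p = x^c z^p − ζ^p x^c` (char `p`):
* ★★ `frobeniusPower_mem_iff_of_pCover` — `(z^p − F)^{p−1} ∈ (z^p, xᵢ^p) ↔ F^{p−1} ∈ (xᵢ^p)`;
* ★★ `frobeniusPower_mem_iff_wildChart` — `(x_{i₀}^c z^p − G)^{p−1} ∈ ((z − ζ)^p, (xᵢ − βᵢ)^p) ↔ (G − ζ^p x_{i₀}^c)^{p−1} ∈ ((xᵢ − βᵢ)^p)`;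
* ★★ the CLAUSE forms `clause_wildChart_iff`, `fullCl_wildChart_iff`, `clause_pCover_origin_iff` — through ✓ `FedderAtMaximalIdeal.fedder_criterion_maximalIdeal`:
  the stalk clause (`CMCl ∧ FCl p`, resp. `FullCl` given the domain clause) of `k[x, z]_P/(g)` at the `k`-point `P = (z − ζ, xᵢ − βᵢ)` of
  `g = x_{i₀}^c z^p − G` holds iff the TWISTED BASE polynomial `G − ζ^p x_{i₀}^c` passes Fedder's test at `β` — one dimension down.
[cite: Fedder1983, Prop. 1.7 and Thm. 1.12]
-/

-- single-problem summit: the doubled namespace component is forced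
set_option linter.dupNamespace false

noncomputable section

open MvPolynomial IsLocalRing

namespace Summit.ResolutionOfSingularities.ResolutionOfSingularities.Theorems.FInjectiveMacaulayfication.WildCoverFedder

open Summit.ResolutionOfSingularities.ResolutionOfSingularities.Theorems.FInjectiveMacaulayfication SliceableCentre

/-! ## §1 Two ring-theoretic facts -/

section Algebra

variable {A B : Type} [CommRing A] [CommRing B]

/-- **`(T − h)^m ∈ J ↔ h^m ∈ J` when `T ∈ J`**: modulo `J`, `T − h ≡ −h` and `(−1)^m` is a unit. [folklore] -/
theorem sub_pow_mem_iff (J : Ideal B) {T : B} (hT : T ∈ J) (h : B) (m : ℕ) : (T - h) ^ m ∈ J ↔ h ^ m ∈ J := by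
  rw [← Ideal.Quotient.eq_zero_iff_mem, ← Ideal.Quotient.eq_zero_iff_mem, map_pow, map_pow, map_sub,
    Ideal.Quotient.eq_zero_iff_mem.mpr hT, zero_sub, neg_pow]
  exact (IsUnit.pow m isUnit_one.neg).mul_right_eq_zero

/-- **Membership along a retraction**: `σ ∘ ι = id`, `ι I ⊆ J`, `σ J ⊆ I` ⇒ (`ι h ∈ J ↔ h ∈ I`). [folklore] -/
theorem mem_iff_of_retract (ι : A →+* B) (σ : B →+* A) (hσι : ∀ a, σ (ι a) = a) {I : Ideal A} {J : Ideal B}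
    (hIJ : I.map ι ≤ J) (hJI : J.map σ ≤ I) (h : A) : ι h ∈ J ↔ h ∈ I :=
  ⟨fun hh => by simpa only [hσι] using hJI (Ideal.mem_map_of_mem σ hh), fun hh => hIJ (Ideal.mem_map_of_mem ι hh)⟩

/-- The same for powers: `(ι h)^m ∈ J ↔ h^m ∈ I`. [folklore] -/
theorem pow_mem_iff_of_retract (ι : A →+* B) (σ : B →+* A) (hσι : ∀ a, σ (ι a) = a) {I : Ideal A} {J : Ideal B}
    (hIJ : I.map ι ≤ J) (hJI : J.map σ ≤ I) (h : A) (m : ℕ) : (ι h) ^ m ∈ J ↔ h ^ m ∈ I := by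
  rw [← map_pow]; exact mem_iff_of_retract ι σ hσι hIJ hJI _

end Algebra

/-! ## §2 The retraction `z ↦ ζ` of `k[x, z] → k[x]` and the Frobenius powers of `k`-points -/

section Retract

variable (k : Type) [Field k] (n : ℕ)

/-- `σ_ζ ∘ ι = id`. [plumbing] -/
theorem evalZ_rename (ζ : k) (F : MvPolynomial (Fin n) k) : (aeval (Fin.cons (C ζ) X : Fin (n + 1) → MvPolynomial (Fin n) k)).toRingHom (rename Fin.succ F) = F := by
  change aeval _ (rename Fin.succ F) = F
  rw [aeval_rename]
  have : ((Fin.cons (C ζ) X : Fin (n + 1) → MvPolynomial (Fin n) k) ∘ Fin.succ) = X := by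
    funext i; simp only [Function.comp_apply, Fin.cons_succ]
  rw [this]
  exact congrFun (congrArg DFunLike.coe (aeval_X_left (R := k) (σ := Fin n))) F

/-- `σ_ζ (z) = ζ`. [plumbing] -/
theorem evalZ_X_zero (ζ : k) : (aeval (Fin.cons (C ζ) X : Fin (n + 1) → MvPolynomial (Fin n) k)).toRingHom (X 0 : MvPolynomial (Fin (n + 1)) k) = C ζ := by
  change aeval _ (X 0) = _; rw [aeval_X, Fin.cons_zero]

/-- `σ_ζ (xᵢ) = xᵢ`. [plumbing] -/
theorem evalZ_X_succ (ζ : k) (i : Fin n) : (aeval (Fin.cons (C ζ) X : Fin (n + 1) → MvPolynomial (Fin n) k)).toRingHom (X i.succ : MvPolynomial (Fin (n + 1)) k) = X i := by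
  change aeval _ (X _) = _; rw [aeval_X, Fin.cons_succ]

/-- `σ_ζ (C a) = C a`. [plumbing] -/
theorem evalZ_C (ζ a : k) : (aeval (Fin.cons (C ζ) X : Fin (n + 1) → MvPolynomial (Fin n) k)).toRingHom (C a : MvPolynomial (Fin (n + 1)) k) = C a := by
  change aeval _ (C a) = _; rw [aeval_C, MvPolynomial.algebraMap_eq]

/-- `ι (xᵢ − βᵢ)^p ∈ ((z − ζ)^p, (xᵢ − βᵢ)^p)`: the point ideal's Frobenius power downstairs extends into the one upstairs. [plumbing] -/
theorem map_rename_span_pow_le (p : ℕ) (ζ : k) (β : Fin n → k) :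
    (Ideal.span (Set.range fun i : Fin n => (X i - C (β i) : MvPolynomial (Fin n) k) ^ p)).map
        (rename Fin.succ : MvPolynomial (Fin n) k →ₐ[k] MvPolynomial (Fin (n + 1)) k).toRingHom ≤
      Ideal.span (Set.range fun j : Fin (n + 1) => (X j - C (Fin.cons ζ β j) : MvPolynomial (Fin (n + 1)) k) ^ p) := by
  rw [Ideal.map_span, Ideal.span_le]
  rintro _ ⟨_, ⟨i, rfl⟩, rfl⟩
  refine Ideal.subset_span ⟨i.succ, ?_⟩
  simp only [AlgHom.toRingHom_eq_coe, RingHom.coe_coe, map_pow, map_sub, rename_X, rename_C, Fin.cons_succ]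

/-- `σ_ζ ((z − ζ)^p, (xᵢ − βᵢ)^p) ⊆ ((xᵢ − βᵢ)^p)` (`p ≥ 1`): the generator `(z − ζ)^p` dies. [plumbing] -/
theorem map_evalZ_span_pow_le {p : ℕ} (hp : p ≠ 0) (ζ : k) (β : Fin n → k) :
    (Ideal.span (Set.range fun j : Fin (n + 1) => (X j - C (Fin.cons ζ β j) : MvPolynomial (Fin (n + 1)) k) ^ p)).map ((aeval (Fin.cons (C ζ) X : Fin (n + 1) → MvPolynomial (Fin n) k)).toRingHom) ≤
      Ideal.span (Set.range fun i : Fin n => (X i - C (β i) : MvPolynomial (Fin n) k) ^ p) := by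
  rw [Ideal.map_span, Ideal.span_le]
  rintro _ ⟨_, ⟨j, rfl⟩, rfl⟩
  refine Fin.cases ?_ (fun i => ?_) j
  · simp only [map_pow, map_sub, evalZ_X_zero, evalZ_C, Fin.cons_zero, sub_self, zero_pow hp]
    exact (Ideal.span _).zero_mem
  · simp only [map_pow, map_sub, evalZ_X_succ, evalZ_C, Fin.cons_succ]
    exact Ideal.subset_span ⟨i, rfl⟩

/-- ★ **A `z`-FREE POLYNOMIAL LIES IN `((z − ζ)^p, (xᵢ − βᵢ)^p)` IFF IT LIES IN `((xᵢ − βᵢ)^p)`** (powers included). [folklore] -/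
theorem rename_pow_mem_span_pow_iff {p : ℕ} (hp : p ≠ 0) (ζ : k) (β : Fin n → k) (H : MvPolynomial (Fin n) k) (m : ℕ) :
    (rename Fin.succ H : MvPolynomial (Fin (n + 1)) k) ^ m ∈
        Ideal.span (Set.range fun j : Fin (n + 1) => (X j - C (Fin.cons ζ β j) : MvPolynomial (Fin (n + 1)) k) ^ p) ↔
      H ^ m ∈ Ideal.span (Set.range fun i : Fin n => (X i - C (β i) : MvPolynomial (Fin n) k) ^ p) :=
  pow_mem_iff_of_retract (rename Fin.succ : MvPolynomial (Fin n) k →ₐ[k] MvPolynomial (Fin (n + 1)) k).toRingHom ((aeval (Fin.cons (C ζ) X : Fin (n + 1) → MvPolynomial (Fin n) k)).toRingHom)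
    (evalZ_rename k n ζ) (map_rename_span_pow_le k n p ζ β) (map_evalZ_span_pow_le k n hp ζ β) H m

end Retract

/-! ## §3 Fedder's test on `z^p = F` and on `x^c z^p = G` -/

section Fedder

variable (k : Type) [Field k] (n : ℕ) (p : ℕ) [Fact p.Prime] [CharP k p]

omit [CharP k p] in
/-- ★★ **THE WILD `p`-COVER AT THE ORIGIN**: `(z^p − F)^{p−1} ∈ (z^p, x₁^p, …, xₙ^p) ↔ F^{p−1} ∈ (x₁^p, …, xₙ^p)` (no characteristic hypothesis) —
FULL of `Y_p : z^p = F` at `0` is Fedder's test for the BASE `F` at `0`. [OURS · #8w W1 dictionary; cite: Fedder1983, Thm. 1.12] -/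
theorem frobeniusPower_mem_iff_of_pCover (F : MvPolynomial (Fin n) k) :
    ((X 0 : MvPolynomial (Fin (n + 1)) k) ^ p - rename Fin.succ F) ^ (p - 1) ∈
        Ideal.span (Set.range fun j : Fin (n + 1) => (X j : MvPolynomial (Fin (n + 1)) k) ^ p) ↔
      F ^ (p - 1) ∈ Ideal.span (Set.range fun i : Fin n => (X i : MvPolynomial (Fin n) k) ^ p) := by
  have hp : p ≠ 0 := (Fact.out : p.Prime).ne_zero
  have hT : (X 0 : MvPolynomial (Fin (n + 1)) k) ^ p ∈ Ideal.span (Set.range fun j : Fin (n + 1) => (X j : MvPolynomial (Fin (n + 1)) k) ^ p) :=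
    Ideal.subset_span ⟨0, rfl⟩
  rw [sub_pow_mem_iff _ hT]
  have h := rename_pow_mem_span_pow_iff k n hp 0 (fun _ => 0) F (p - 1)
  have e1 : (fun j : Fin (n + 1) => (X j - C (Fin.cons (0 : k) (fun _ : Fin n => (0 : k)) j) : MvPolynomial (Fin (n + 1)) k) ^ p) =
      fun j => X j ^ p := by
    funext j; refine Fin.cases ?_ (fun i => ?_) j <;> simp
  have e2 : (fun i : Fin n => (X i - C ((fun _ : Fin n => (0 : k)) i) : MvPolynomial (Fin n) k) ^ p) = fun i => X i ^ p := by
    funext i; simp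
  rw [e1, e2] at h
  exact h

/-- ★★ **THE WILD CHART AT A `k`-POINT** `(ζ, β)`: `(x_{i₀}^c z^p − G)^{p−1} ∈ ((z − ζ)^p, (xᵢ − βᵢ)^p) ↔ (G − ζ^p x_{i₀}^c)^{p−1} ∈ ((xᵢ − βᵢ)^p)`
— since `x^c z^p − G = x^c (z − ζ)^p − (G − ζ^p x^c)` in characteristic `p`. FULL of the chart `x^c z^p = G` of `Bl_0 Y_p` at `(ζ, β)` is
Fedder's test for the ζ-TWISTED BASE `G − ζ^p x^c` at `β`. [OURS · #8w W1 dictionary; cite: Fedder1983, Thm. 1.12] -/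
theorem frobeniusPower_mem_iff_wildChart (c : ℕ) (i₀ : Fin n) (G : MvPolynomial (Fin n) k) (ζ : k) (β : Fin n → k) :
    ((X i₀.succ : MvPolynomial (Fin (n + 1)) k) ^ c * X 0 ^ p - rename Fin.succ G) ^ (p - 1) ∈
        Ideal.span (Set.range fun j : Fin (n + 1) => (X j - C (Fin.cons ζ β j) : MvPolynomial (Fin (n + 1)) k) ^ p) ↔
      (G - C (ζ ^ p) * X i₀ ^ c) ^ (p - 1) ∈ Ideal.span (Set.range fun i : Fin n => (X i - C (β i) : MvPolynomial (Fin n) k) ^ p) := by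
  have hp : p ≠ 0 := (Fact.out : p.Prime).ne_zero
  -- `x^c z^p − G = x^c (z − ζ)^p − ι(G − ζ^p x^c)`
  have hid : ((X i₀.succ : MvPolynomial (Fin (n + 1)) k) ^ c * X 0 ^ p - rename Fin.succ G) =
      (X i₀.succ : MvPolynomial (Fin (n + 1)) k) ^ c * (X 0 - C ζ) ^ p - rename Fin.succ (G - C (ζ ^ p) * X i₀ ^ c) := by
    rw [sub_pow_char (X 0 : MvPolynomial (Fin (n + 1)) k) (C ζ)]
    simp only [map_sub, map_mul, map_pow, rename_X, rename_C]
    ring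
  have hT : (X i₀.succ : MvPolynomial (Fin (n + 1)) k) ^ c * (X 0 - C ζ) ^ p ∈
      Ideal.span (Set.range fun j : Fin (n + 1) => (X j - C (Fin.cons ζ β j) : MvPolynomial (Fin (n + 1)) k) ^ p) :=
    Ideal.mul_mem_left _ _ (Ideal.subset_span ⟨0, by simp only [Fin.cons_zero]⟩)
  rw [hid, sub_pow_mem_iff _ hT]
  exact rename_pow_mem_span_pow_iff k n hp ζ β _ _

/-- `0 ∉ range succ`. [plumbing] -/
theorem zero_not_mem_range_succ : (0 : Fin (n + 1)) ∉ Set.range (Fin.succ : Fin n → Fin (n + 1)) := by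
  rintro ⟨i, hi⟩; exact Fin.succ_ne_zero i hi

/-- A `z`-free polynomial has no monomial involving `z`. [plumbing] -/
theorem coeff_rename_succ_eq_zero (G : MvPolynomial (Fin n) k) (d : Fin (n + 1) →₀ ℕ) (hd : d 0 ≠ 0) :
    coeff d (rename Fin.succ G : MvPolynomial (Fin (n + 1)) k) = 0 := by
  apply coeff_rename_eq_zero
  intro u hu
  exfalso
  apply hd
  rw [← hu]
  exact Finsupp.mapDomain_notin_range _ _ (zero_not_mem_range_succ n)

omit [CharP k p] in
/-- The chart equation `x_{i₀}^c z^p − G` is nonzero (`G` `z`-free). [plumbing] -/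
theorem wildChart_ne_zero (c : ℕ) (i₀ : Fin n) (G : MvPolynomial (Fin n) k) :
    ((X i₀.succ : MvPolynomial (Fin (n + 1)) k) ^ c * X 0 ^ p - rename Fin.succ G) ≠ 0 := by
  have hp : p ≠ 0 := (Fact.out : p.Prime).ne_zero
  intro h
  have hmon : (X i₀.succ : MvPolynomial (Fin (n + 1)) k) ^ c * X 0 ^ p = monomial (Finsupp.single 0 p + Finsupp.single i₀.succ c) 1 := by
    rw [X_pow_eq_monomial, X_pow_eq_monomial, monomial_mul, mul_one, add_comm (Finsupp.single i₀.succ c)]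
  have h1 := congrArg (coeff (Finsupp.single (0 : Fin (n + 1)) p + Finsupp.single i₀.succ c)) h
  rw [coeff_sub, coeff_zero, sub_eq_zero, hmon, coeff_monomial, if_pos rfl,
    coeff_rename_succ_eq_zero k n G _ (by simp [Fin.succ_ne_zero, hp])] at h1
  exact one_ne_zero h1

omit [CharP k p] in
/-- The cover equation `z^p − F` is nonzero (`F` `z`-free). [plumbing] -/
theorem pCover_ne_zero (F : MvPolynomial (Fin n) k) : ((X 0 : MvPolynomial (Fin (n + 1)) k) ^ p - rename Fin.succ F) ≠ 0 := by
  have hp : p ≠ 0 := (Fact.out : p.Prime).ne_zero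
  intro h
  have h1 := congrArg (coeff (Finsupp.single (0 : Fin (n + 1)) p)) h
  rw [coeff_sub, coeff_zero, sub_eq_zero, X_pow_eq_monomial, coeff_monomial, if_pos rfl,
    coeff_rename_succ_eq_zero k n F _ (by simp [hp])] at h1
  exact one_ne_zero h1

/-! ## §4 The clause forms (through ✓ `fedder_criterion_maximalIdeal`) -/

/-- ★★ **THE STALK CLAUSE OF THE WILD CHART LIVES ONE DIMENSION DOWN**: at the `k`-point `P = (z − ζ, xᵢ − βᵢ)` of `g = x_{i₀}^c z^p − G`,
`CMCl ∧ FCl p` of `k[z, x]_P/(g)` holds iff the twisted base `G − ζ^p x_{i₀}^c` passes Fedder's test at `β`: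
`(G − ζ^p x_{i₀}^c)^{p−1} ∉ ((xᵢ − βᵢ)^p)`. [OURS · #8w W1; cite: Fedder1983, Prop. 1.7 and Thm. 1.12] -/
theorem clause_wildChart_iff (c : ℕ) (i₀ : Fin n) (G : MvPolynomial (Fin n) k) (ζ : k) (β : Fin n → k)
    (P : Ideal (MvPolynomial (Fin (n + 1)) k)) [P.IsMaximal]
    (hP : P = Ideal.span (Set.range fun j : Fin (n + 1) => (X j - C (Fin.cons ζ β j) : MvPolynomial (Fin (n + 1)) k)))
    (hgP : ((X i₀.succ : MvPolynomial (Fin (n + 1)) k) ^ c * X 0 ^ p - rename Fin.succ G) ∈ P) :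
    (CMCl (Localization.AtPrime P ⧸ Ideal.span {algebraMap (MvPolynomial (Fin (n + 1)) k) (Localization.AtPrime P)
        ((X i₀.succ : MvPolynomial (Fin (n + 1)) k) ^ c * X 0 ^ p - rename Fin.succ G)}) ∧
      FCl p (Localization.AtPrime P ⧸ Ideal.span {algebraMap (MvPolynomial (Fin (n + 1)) k) (Localization.AtPrime P)
        ((X i₀.succ : MvPolynomial (Fin (n + 1)) k) ^ c * X 0 ^ p - rename Fin.succ G)})) ↔
      (G - C (ζ ^ p) * X i₀ ^ c) ^ (p - 1) ∉ Ideal.span (Set.range fun i : Fin n => (X i - C (β i) : MvPolynomial (Fin n) k) ^ p) := by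
  rw [SeparableBaseChangeAscent.cmCl_and_fCl_iff,
    FedderAtMaximalIdeal.fedder_criterion_maximalIdeal k (n + 1) (n + 1) p P _ hP _ hgP (wildChart_ne_zero k n p c i₀ G),
    frobeniusPower_mem_iff_wildChart]

/-- ★★ **FULL OF THE WILD CHART AT A `k`-POINT** (the domain clause supplied): `FullCl p (k[z,x]_P/(g)) ↔` Fedder's test for the twisted base at `β`.
[OURS · #8w W1] -/
theorem fullCl_wildChart_iff (c : ℕ) (i₀ : Fin n) (G : MvPolynomial (Fin n) k) (ζ : k) (β : Fin n → k)
    (P : Ideal (MvPolynomial (Fin (n + 1)) k)) [P.IsMaximal]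
    (hP : P = Ideal.span (Set.range fun j : Fin (n + 1) => (X j - C (Fin.cons ζ β j) : MvPolynomial (Fin (n + 1)) k)))
    (hgP : ((X i₀.succ : MvPolynomial (Fin (n + 1)) k) ^ c * X 0 ^ p - rename Fin.succ G) ∈ P)
    (hdom : IsDomain (Localization.AtPrime P ⧸ Ideal.span {algebraMap (MvPolynomial (Fin (n + 1)) k) (Localization.AtPrime P)
        ((X i₀.succ : MvPolynomial (Fin (n + 1)) k) ^ c * X 0 ^ p - rename Fin.succ G)})) :
    FullCl p (Localization.AtPrime P ⧸ Ideal.span {algebraMap (MvPolynomial (Fin (n + 1)) k) (Localization.AtPrime P)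
        ((X i₀.succ : MvPolynomial (Fin (n + 1)) k) ^ c * X 0 ^ p - rename Fin.succ G)}) ↔
      (G - C (ζ ^ p) * X i₀ ^ c) ^ (p - 1) ∉ Ideal.span (Set.range fun i : Fin n => (X i - C (β i) : MvPolynomial (Fin n) k) ^ p) := by
  rw [← clause_wildChart_iff k n p c i₀ G ζ β P hP hgP, SeparableBaseChangeAscent.cmCl_and_fCl_iff]
  exact ⟨fun h => h.2, fun h => ⟨hdom, h⟩⟩

/-- ★★ **FULL(`Y_p` AT THE ORIGIN) ⟺ FEDDER(`F`) AT THE ORIGIN**: for `F(0) = 0`, the stalk clause `CMCl ∧ FCl p` of `k[z,x]_𝔪/(z^p − F)` at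
`𝔪 = (z, x₁, …, xₙ)` holds iff `F^{p−1} ∉ (x₁^p, …, xₙ^p)`. [OURS · #8w W1; cite: Fedder1983, Prop. 1.7 and Thm. 1.12] -/
theorem clause_pCover_origin_iff (F : MvPolynomial (Fin n) k) (P : Ideal (MvPolynomial (Fin (n + 1)) k)) [P.IsMaximal]
    (hP : P = Ideal.span (Set.range (X : Fin (n + 1) → MvPolynomial (Fin (n + 1)) k)))
    (hFP : ((X 0 : MvPolynomial (Fin (n + 1)) k) ^ p - rename Fin.succ F) ∈ P) :
    (CMCl (Localization.AtPrime P ⧸ Ideal.span {algebraMap (MvPolynomial (Fin (n + 1)) k) (Localization.AtPrime P)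
        ((X 0 : MvPolynomial (Fin (n + 1)) k) ^ p - rename Fin.succ F)}) ∧
      FCl p (Localization.AtPrime P ⧸ Ideal.span {algebraMap (MvPolynomial (Fin (n + 1)) k) (Localization.AtPrime P)
        ((X 0 : MvPolynomial (Fin (n + 1)) k) ^ p - rename Fin.succ F)})) ↔
      F ^ (p - 1) ∉ Ideal.span (Set.range fun i : Fin n => (X i : MvPolynomial (Fin n) k) ^ p) := by
  rw [SeparableBaseChangeAscent.cmCl_and_fCl_iff,
    FedderAtMaximalIdeal.fedder_criterion_maximalIdeal k (n + 1) (n + 1) p P X hP _ hFP (pCover_ne_zero k n p F),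
    frobeniusPower_mem_iff_of_pCover]

end Fedder

end Summit.ResolutionOfSingularities.ResolutionOfSingularities.Theorems.FInjectiveMacaulayfication.WildCoverFedder

end
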